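import Literature.Computability.ImplicitComplexity.SoftTypeAssignmentNPSound
import Literature.Computability.ImplicitComplexity.SoftTypeAssignmentNPProgram
import HarnessLib

/-!
# `STA₊` captures NP: the discharge of `STAPlusCapturesNP`

Gaboardi–Marion–Ronchi Della Rocca 2008 (GMR08), **Thm. 5.12** (NP-soundness: a typed `STA₊` term
evaluates to each of its normal forms in nondeterministic polynomial time — here: the sharing
machine of `SoftTypeAssignmentMachine*.lean` fed with the choice bits is a polynomial-time
`FinTM2`-verifier, `SoftTypeAssignmentNPSound.lean`) and **Thm. 5.14** (NP-completeness: every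
problem of NP is programmed by a typed `STA₊` term whose transition relation is a SUM of
deterministic transition terms — here: the tableau passes of `SoftTypeAssignmentTableauCA.lean`,
the certificate-writing summands and the start row of `SoftTypeAssignmentTableauIO/Row0.lean`,
assembled in `SoftTypeAssignmentNPProgram.lean`), for the tree's class
`NP = polyExists P` over Mathlib's `FinTM2` deciders and the tree's notion
`SoftSumRepresentsAtLevel` (GMR08 Def. 5.13).

## References

* [GaboardiMarionRonchidellarocca2008] Thm. 5.12, Thm. 5.14, Def. 5.13.
-/

namespace Literature.Computability.ImplicitComplexity

/-- **`STA₊` captures NP** (GMR08 Thm. 5.12 + Thm. 5.14 with Def. 5.13), proved for the tree's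
classes: a language is in `NP` iff it is soft-sum-representable at some level.
[cite: GaboardiMarionRonchidellarocca2008, Thm. 5.12 and Thm. 5.14 (with Def. 5.13)] -/
theorem STAPlusCapturesNP_holds : STAPlusCapturesNP := fun _ =>
  ⟨STA.TabCA.exists_softSum_of_mem_NP, STA.mem_NP_of_exists_level⟩

end Literature.Computability.ImplicitComplexity
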